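import Mathlib
import HarnessLib
import Summits.NavierStokesRegularity.NavierStokesRegularity.Theorems.PoloidalWindowDoorPoloidalWindowRigidityUntwistedBracket
import Summits.NavierStokesRegularity.NavierStokesRegularity.Theorems.PoloidalWindowDoorPoloidalWindowRigidityUntwistedSliceGlue
import Summits.NavierStokesRegularity.NavierStokesRegularity.Theorems.PoloidalWindowDoorPoloidalWindowRigidityClebsch
import Summits.NavierStokesRegularity.NavierStokesRegularity.Theorems.PoloidalWindowDoorPoloidalWindowRigidityFirstIntegral
import Summits.NavierStokesRegularity.NavierStokesRegularity.Theorems.PoloidalWindowDoorLrcModEntireStreamSymmetryGerm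
import Summits.NavierStokesRegularity.NavierStokesRegularity.Theorems.PoloidalWindowDoorPoloidalWindowRigidityOneSliceCurlAxisymmetric
import Summits.NavierStokesRegularity.NavierStokesRegularity.Theorems.PoloidalWindowDoorPoloidalWindowRigidityLocalVorticitySymmetry
import Summits.NavierStokesRegularity.NavierStokesRegularity.Theorems.PoloidalWindowDoorLrcModEntireAxisKinematics

/-!
# Route `PoloidalWindowDoor`, crux `PoloidalWindowRigidity` (K2, stmt-NavierStokesRegularity-19708), skeleton `lrc-jet` v5,
# stub `stub_untwisted` — brick F5b: THE ENDGAME (isoparametric base plane + untwisted ⇒ Killing germ of the vorticity ⇒ regular apex)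

Cell ns-regularity-ideate, K2 lead ns-poloidal-K2-p1 (gen 6; `--supports stmt-NavierStokesRegularity-19708`, helper; BRIEF-v5-bricks-v2 (S2)).

For a profile of the route's Type-I class, poloidal along `e₃`, one slice `s < 0`, `w := v₂(s,·)`, and a coordinate box `B` around `y₁`:
if `w` is untwisted on `B` (`∂₂w = P(w,y₂)`), non-degenerate (`∇ₕw ≠ 0`), and ISOPARAMETRIC ON THE BASE PLANE `{y₂ = (y₁)₂}` of the box
(`|∇ₕw|² = a(w)`, `Δₕw = b(w)` there, `a ∈ C²`, `b ∈ C¹` — the output of bricks F3a/F3b restricted to one height), then the apex is regular: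
ns-poloidal-K2-p3's slice form of the planar Levi-Civita–Segre theorem (`circles_or_lines_of_isoparametric_slice`, p548451) makes `∇ₕw` radial
from one centre or parallel to one direction on a planar disc of the base plane; the bracket lemma (brick F1′, p550287) transports the direction of
`∇ₕw` up the vertical segments of the box, so `w` — and by the frozen constraint (`frozen_bracket`) the Clebsch stream function `ψ` — has a
rotation germ about ONE vertical axis or a horizontal translation germ on an open set; K2-p3's `vorticity_rotation_germ_of_stream` /
`vorticity_translation_germ_of_stream` and the tree's `nonflatLiouville_of_curl_rotDefect_eq_zero_on_open` / `nonflatLiouville_of_local_curl_translation`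
finish.

* `regular_of_isoparametric_base` — the statement above.

WHAT THIS IS NOT: not the stub (its separation part is bricks F2–F4) — the closing glue (bears_on LADDER-NS N0 via crux K2 = stmt-19708).
-/

noncomputable section

-- the summit and its single sub-problem share the name (CONVENTIONS §1), as in every Theorems file
set_option linter.dupNamespace false

namespace Summit.NavierStokesRegularity.NavierStokesRegularity.Theorems.PoloidalWindowDoorPoloidalWindowRigidityUntwistedEndgame

open Set Function Filter Topology Metric
open scoped RealInnerProductSpace InnerProductSpace
open Literature.Analysis Literature.Analysis.FluidPDE
open Summit.NavierStokesRegularity.NavierStokesRegularity.Theorems.LocalSineTubeDoorProfileAlignedWindowRigidityAncient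
open Summit.NavierStokesRegularity.NavierStokesRegularity.Theorems.PoloidalWindowDoorPoloidalWindowRigidityConstantShearMeans
open Summit.NavierStokesRegularity.NavierStokesRegularity.Theorems.PoloidalWindowDoorPoloidalWindowRigidityUntwistedSeparation
open Summit.NavierStokesRegularity.NavierStokesRegularity.Theorems.PoloidalWindowDoorPoloidalWindowRigidityUntwistedBracket
open Summit.NavierStokesRegularity.NavierStokesRegularity.Theorems.PoloidalWindowDoorPoloidalWindowRigidityUntwistedSliceGlue
open Summit.NavierStokesRegularity.NavierStokesRegularity.Theorems.PoloidalWindowDoorPoloidalWindowRigidityClebsch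
open Summit.NavierStokesRegularity.NavierStokesRegularity.Theorems.PoloidalWindowDoorPoloidalWindowRigidityFirstIntegral
open Summit.NavierStokesRegularity.NavierStokesRegularity.Theorems.PoloidalWindowDoorLrcModEntireStreamSymmetryGerm
open Summit.NavierStokesRegularity.NavierStokesRegularity.Theorems.PoloidalWindowDoorPoloidalWindowRigidityOneSliceCurlAxisymmetric
open Summit.NavierStokesRegularity.NavierStokesRegularity.Theorems.PoloidalWindowDoorPoloidalWindowRigidityLocalVorticitySymmetry
open Summit.NavierStokesRegularity.NavierStokesRegularity.Theorems.PoloidalWindowDoorLrcModEntireAxisKinematics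

variable {C : ℝ} {v : ℝ → EuclideanSpace ℝ (Fin 3) → EuclideanSpace ℝ (Fin 3)}

/-- **THE ENDGAME OF `stub_untwisted`.**  Class + poloidal profile, slice `s < 0`, `w = v₂(s,·)`; on the open coordinate box of radius `r` about `y₁`:
`∂₂w = P(w,y₂)` (`P ∈ C¹` at the leaf points), `∇ₕw ≠ 0`, and on its base plane `y₂ = (y₁)₂`: `|∇ₕw|² = a(w)`, `Δₕw = b(w)` with `a ∈ C²`, `b ∈ C¹`.
Then `v` is not backward-singular at the apex. [folklore] -/
theorem regular_of_isoparametric_base (hrate : HasTypeITimeDecay C v)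
    (hcont : ContinuousOn (uncurry v) (Iio (0 : ℝ) ×ˢ univ))
    (hmild : ∀ s t : ℝ, s < t → t < 0 → ∀ x,
      v t x = UnboundedOperators.heatExtension (v s) (t - s) x - oseenDuhamel 1 s v v t x)
    (hdiv : ∀ t < 0, VectorCalculus.IsDivFree (v t))
    (hpol : ∀ s < 0, ∀ y, ⟪curl (v s) y, EuclideanSpace.single 2 1⟫_ℝ = 0)
    {s : ℝ} (hs : s < 0) {y₁ : EuclideanSpace ℝ (Fin 3)} {r : ℝ} (hr : 0 < r) {P : ℝ × ℝ → ℝ}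
    (hPc : ∀ y : EuclideanSpace ℝ (Fin 3), (∀ i, |y i - y₁ i| < r) → ContDiffAt ℝ 1 P (v s y 2, y 2))
    (hP : ∀ y : EuclideanSpace ℝ (Fin 3), (∀ i, |y i - y₁ i| < r) →
      fderiv ℝ (fun x => v s x 2) y (EuclideanSpace.single 2 (1 : ℝ)) = P (v s y 2, y 2))
    (hnd : ∀ y : EuclideanSpace ℝ (Fin 3), (∀ i, |y i - y₁ i| < r) →
      fderiv ℝ (fun x => v s x 2) y (EuclideanSpace.single 0 (1 : ℝ)) ≠ 0 ∨
        fderiv ℝ (fun x => v s x 2) y (EuclideanSpace.single 1 (1 : ℝ)) ≠ 0)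
    {a b : ℝ → ℝ} (ha : ContDiff ℝ 2 a) (hb : ContDiff ℝ 1 b)
    (h₁ : ∀ y : EuclideanSpace ℝ (Fin 3), (∀ i, |y i - y₁ i| < r) → y 2 = y₁ 2 →
      (fderiv ℝ (fun x => v s x 2) y (EuclideanSpace.single 0 1)) ^ 2 +
        (fderiv ℝ (fun x => v s x 2) y (EuclideanSpace.single 1 1)) ^ 2 = a (v s y 2))
    (h₂ : ∀ y : EuclideanSpace ℝ (Fin 3), (∀ i, |y i - y₁ i| < r) → y 2 = y₁ 2 →
      fderiv ℝ (fun y' => fderiv ℝ (fun x => v s x 2) y' (EuclideanSpace.single 0 1)) y (EuclideanSpace.single 0 1) +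
        fderiv ℝ (fun y' => fderiv ℝ (fun x => v s x 2) y' (EuclideanSpace.single 1 1)) y (EuclideanSpace.single 1 1) =
          b (v s y 2)) :
    ¬ IsBackwardSingularPoint v 0 := by
  -- the slice `w` and its regularity
  set w : EuclideanSpace ℝ (Fin 3) → ℝ := fun x => v s x 2 with hw
  have hAn : AnalyticOnNhd ℝ (v s) univ := analyticOnNhd_slice hcont (bdd_of_hasTypeITimeDecay hrate) hmild hs
  have hwA : AnalyticOnNhd ℝ w univ := by
    have h1 := (EuclideanSpace.proj (2 : Fin 3) : EuclideanSpace ℝ (Fin 3) →L[ℝ] ℝ).comp_analyticOnNhd hAn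
    exact AnalyticOnNhd.congr isOpen_univ h1 (fun y _ => by simp [hw, Function.comp])
  have hw2 : ContDiff ℝ 2 w := hwA.contDiff
  have hw3 : ContDiff ℝ 3 w := hwA.contDiff
  have hwd : Differentiable ℝ w := hw2.differentiable (by norm_num)
  -- the box
  set B : Set (EuclideanSpace ℝ (Fin 3)) := {y | ∀ i, |y i - y₁ i| < r} with hB
  have hBo : IsOpen B := by
    rw [hB, show {y : EuclideanSpace ℝ (Fin 3) | ∀ i, |y i - y₁ i| < r} = ⋂ i, {y | |y i - y₁ i| < r} by ext y; simp]
    exact isOpen_iInter_of_finite fun i =>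
      isOpen_lt (continuous_abs.comp (((EuclideanSpace.proj i).continuous).sub continuous_const)) continuous_const
  have hy₁B : y₁ ∈ B := fun i => by simp [hr]
  -- Segre on the base plane
  set z₁ : ℝ := y₁ 2 with hz₁
  set x₀ : EuclideanSpace ℝ (Fin 2) := WithLp.toLp 2 ![y₁ 0, y₁ 1] with hx₀
  have hιy₁ : (WithLp.toLp 2 ![x₀ 0, x₀ 1, z₁] : EuclideanSpace ℝ (Fin 3)) = y₁ := by
    ext j; fin_cases j <;> simp [hx₀, hz₁]
  have hx₀B : (WithLp.toLp 2 ![x₀ 0, x₀ 1, z₁] : EuclideanSpace ℝ (Fin 3)) ∈ B := by rw [hιy₁]; exact hy₁B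
  have hpos : 0 < a (w (WithLp.toLp 2 ![x₀ 0, x₀ 1, z₁])) := by
    rw [hιy₁, ← h₁ y₁ hy₁B rfl]
    rcases hnd y₁ hy₁B with h | h
    · have := sq_pos_of_ne_zero h; positivity
    · have := sq_pos_of_ne_zero h; positivity
  obtain ⟨V, hVo, hVne, hVB, hdich⟩ := circles_or_lines_of_isoparametric_slice (f := w) hBo (hw3.contDiffOn) ha hb
    (z := z₁) (x₀ := x₀) hx₀B (fun y hy hyz => h₁ y hy hyz) (fun y hy hyz => h₂ y hy hyz) hpos
  -- the open set `O = B ∩ π⁻¹(V)` and feet of its points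
  set π : EuclideanSpace ℝ (Fin 3) → EuclideanSpace ℝ (Fin 2) := fun y => WithLp.toLp 2 ![y 0, y 1] with hπ
  have hπc : Continuous π := by
    rw [hπ]
    refine (PiLp.continuous_toLp 2 _).comp ?_
    refine continuous_pi fun i => ?_
    fin_cases i
    · simpa using (EuclideanSpace.proj (0 : Fin 3) : EuclideanSpace ℝ (Fin 3) →L[ℝ] ℝ).continuous
    · simpa using (EuclideanSpace.proj (1 : Fin 3) : EuclideanSpace ℝ (Fin 3) →L[ℝ] ℝ).continuous
  set O : Set (EuclideanSpace ℝ (Fin 3)) := B ∩ π ⁻¹' V with hO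
  have hOo : IsOpen O := hBo.inter (hVo.preimage hπc)
  obtain ⟨xV, hxV⟩ := hVne
  have hOne : O.Nonempty := by
    refine ⟨WithLp.toLp 2 ![xV 0, xV 1, z₁], hVB xV hxV, ?_⟩
    show π (WithLp.toLp 2 ![xV 0, xV 1, z₁]) ∈ V
    have e : π (WithLp.toLp 2 ![xV 0, xV 1, z₁]) = xV := by ext j; fin_cases j <;> simp [hπ]
    rw [e]; exact hxV
  -- the foot of `y ∈ O` and the parallelism of the horizontal gradients (brick F1′)
  have hfoot_eq : ∀ y : EuclideanSpace ℝ (Fin 3), (WithLp.toLp 2 ![y 0, y 1, z₁] : EuclideanSpace ℝ (Fin 3)) +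
      (y 2 - (WithLp.toLp 2 ![y 0, y 1, z₁] : EuclideanSpace ℝ (Fin 3)) 2) • EuclideanSpace.single (2 : Fin 3) (1 : ℝ) = y := by
    intro y; ext j; fin_cases j <;> simp
  have hPd : ∀ y ∈ B, ContDiffAt ℝ 1 P (w y, y 2) := fun y hy => hPc y hy
  have hP' : ∀ y ∈ B, fderiv ℝ w y (EuclideanSpace.single 2 (1 : ℝ)) = P (w y, y 2) := fun y hy => hP y hy
  have hpar : ∀ y ∈ O,
      fderiv ℝ w y (EuclideanSpace.single 0 (1 : ℝ)) * fderiv ℝ w (WithLp.toLp 2 ![y 0, y 1, z₁]) (EuclideanSpace.single 1 (1 : ℝ)) -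
        fderiv ℝ w y (EuclideanSpace.single 1 (1 : ℝ)) * fderiv ℝ w (WithLp.toLp 2 ![y 0, y 1, z₁]) (EuclideanSpace.single 0 (1 : ℝ)) = 0 := by
    intro y hy
    set yf : EuclideanSpace ℝ (Fin 3) := WithLp.toLp 2 ![y 0, y 1, z₁] with hyf
    have hyf2 : yf 2 = z₁ := by simp [hyf]
    have hseg : ∀ ζ' ∈ uIcc (yf 2) (y 2), yf + (ζ' - yf 2) • EuclideanSpace.single (2 : Fin 3) (1 : ℝ) ∈ B := by
      intro ζ' hζ' i
      fin_cases i
      · simpa [hyf, hπ] using hy.1 0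
      · simpa [hyf, hπ] using hy.1 1
      · -- the height `ζ'` lies between `z₁ = (y₁)₂` and `y₂`, both within `r` of `(y₁)₂`
        have h2 := hy.1 2
        rw [hyf2] at hζ'
        simp only [hyf]
        simp
        rw [abs_lt] at h2 ⊢
        rcases le_total z₁ (y 2) with hle | hle
        · rw [uIcc_of_le hle] at hζ'; constructor <;> linarith [hζ'.1, hζ'.2, hz₁]
        · rw [uIcc_of_ge hle] at hζ'; constructor <;> linarith [hζ'.1, hζ'.2, hz₁]
    have h := bracket_eq_zero_on_vertical_segment (y := yf) (ζ := y 2) hBo hw2 hPd hP' hseg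
    rw [hfoot_eq y] at h
    exact h
  -- non-degeneracy at the feet
  have hfootB : ∀ y ∈ O, (WithLp.toLp 2 ![y 0, y 1, z₁] : EuclideanSpace ℝ (Fin 3)) ∈ B := fun y hy => by
    simpa [hπ] using hVB (π y) hy.2
  -- Clebsch stream function with the frozen bracket
  have hfi := stub_firstIntegral C v hrate hcont hmild hdiv (EuclideanSpace.single 2 1) hpol
  obtain ⟨φ, ψ, -, hψ, -, -, -, -, hcomp, -, -, -⟩ := exists_clebsch_slice hrate hcont hmild hdiv hpol hs
  have hψ2 : ContDiff ℝ 2 ψ := hψ.of_le (WithTop.coe_le_coe.mpr le_top)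
  have hvd : Differentiable ℝ (v s) := (hAn.contDiff (n := 1)).differentiable one_ne_zero
  -- frozen bracket in `w`-currency: `∂₁ψ ∂₀w − ∂₀ψ ∂₁w = 0`
  have hbr : ∀ y, fderiv ℝ ψ y (EuclideanSpace.single 1 1) * fderiv ℝ w y (EuclideanSpace.single 0 (1 : ℝ)) -
      fderiv ℝ ψ y (EuclideanSpace.single 0 1) * fderiv ℝ w y (EuclideanSpace.single 1 (1 : ℝ)) = 0 := by
    intro y
    have h := frozen_bracket (v := v) (s := s) (hfi s hs) hcomp y
    rw [← fderiv_coord_apply (hvd y) 2, ← fderiv_coord_apply (hvd y) 2] at h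
    exact h
  -- transfer of a horizontal Killing germ from `w` to `ψ`: if `Dw(y)[K] = 0` for `K = k₀e₀ + k₁e₁` and `∇ₕw(y) ≠ 0` then `Dψ(y)[K] = 0`
  have htransfer : ∀ y ∈ B, ∀ k₀ k₁ : ℝ,
      k₀ * fderiv ℝ w y (EuclideanSpace.single 0 (1 : ℝ)) + k₁ * fderiv ℝ w y (EuclideanSpace.single 1 (1 : ℝ)) = 0 →
      k₀ * fderiv ℝ ψ y (EuclideanSpace.single 0 (1 : ℝ)) + k₁ * fderiv ℝ ψ y (EuclideanSpace.single 1 (1 : ℝ)) = 0 := by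
    intro y hy k₀ k₁ hk
    have hb := hbr y
    rcases hnd y hy with hg | hg
    · have : fderiv ℝ w y (EuclideanSpace.single 0 (1 : ℝ)) *
          (k₀ * fderiv ℝ ψ y (EuclideanSpace.single 0 (1 : ℝ)) + k₁ * fderiv ℝ ψ y (EuclideanSpace.single 1 (1 : ℝ))) = 0 := by
        linear_combination (fderiv ℝ ψ y (EuclideanSpace.single 0 (1 : ℝ))) * hk + k₁ * hb
      exact (mul_eq_zero.mp this).resolve_left hg
    · have : fderiv ℝ w y (EuclideanSpace.single 1 (1 : ℝ)) *
          (k₀ * fderiv ℝ ψ y (EuclideanSpace.single 0 (1 : ℝ)) + k₁ * fderiv ℝ ψ y (EuclideanSpace.single 1 (1 : ℝ))) = 0 := by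
        linear_combination (fderiv ℝ ψ y (EuclideanSpace.single 1 (1 : ℝ))) * hk - k₀ * hb
      exact (mul_eq_zero.mp this).resolve_left hg
  -- coordinates of feet
  have hπ0 : ∀ y : EuclideanSpace ℝ (Fin 3), (π y) 0 = y 0 := fun y => by simp [hπ]
  have hπ1 : ∀ y : EuclideanSpace ℝ (Fin 3), (π y) 1 = y 1 := fun y => by simp [hπ]
  rcases hdich with ⟨c, hrad⟩ | ⟨hg₀, hlines⟩
  · -- CIRCLES: rotation germ about the vertical axis through `c`
    set c3 : EuclideanSpace ℝ (Fin 3) := WithLp.toLp 2 ![c 0, c 1, 0] with hc3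
    have hc30 : c3 0 = c 0 := by simp [hc3]
    have hc31 : c3 1 = c 1 := by simp [hc3]
    -- rotation germ of `w` on `O`: `(y₀−c₀)∂₁w − (y₁−c₁)∂₀w = 0`
    have hrotw : ∀ y ∈ O, (y 0 - c 0) * fderiv ℝ w y (EuclideanSpace.single 1 (1 : ℝ)) -
        (y 1 - c 1) * fderiv ℝ w y (EuclideanSpace.single 0 (1 : ℝ)) = 0 := by
      intro y hy
      obtain ⟨h0f, h1f⟩ := hrad (π y) hy.2
      simp only [hπ0, hπ1] at h0f h1f
      have h0f' : fderiv ℝ w (WithLp.toLp 2 ![y 0, y 1, z₁]) (EuclideanSpace.single 0 (1 : ℝ)) =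
          (b (w (WithLp.toLp 2 ![y 0, y 1, z₁])) - deriv a (w (WithLp.toLp 2 ![y 0, y 1, z₁])) / 2) * (y 0 - c 0) := by
        simpa [hπ] using h0f
      have h1f' : fderiv ℝ w (WithLp.toLp 2 ![y 0, y 1, z₁]) (EuclideanSpace.single 1 (1 : ℝ)) =
          (b (w (WithLp.toLp 2 ![y 0, y 1, z₁])) - deriv a (w (WithLp.toLp 2 ![y 0, y 1, z₁])) / 2) * (y 1 - c 1) := by
        simpa [hπ] using h1f
      set lam := b (w (WithLp.toLp 2 ![y 0, y 1, z₁])) - deriv a (w (WithLp.toLp 2 ![y 0, y 1, z₁])) / 2 with hlam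
      have hlam0 : lam ≠ 0 := by
        intro h0
        rcases hnd _ (hfootB y hy) with h | h
        · exact h (by rw [h0f', h0, zero_mul])
        · exact h (by rw [h1f', h0, zero_mul])
      have hp := hpar y hy
      rw [h0f', h1f'] at hp
      have : lam * ((y 0 - c 0) * fderiv ℝ w y (EuclideanSpace.single 1 (1 : ℝ)) -
          (y 1 - c 1) * fderiv ℝ w y (EuclideanSpace.single 0 (1 : ℝ))) = 0 := by linear_combination -hp
      exact (mul_eq_zero.mp this).resolve_left hlam0
    -- rotation germ of `ψ` on `O`
    have hrotψ : ∀ y ∈ O, fderiv ℝ ψ y (rotGen (y - c3)) = 0 := by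
      intro y hy
      rw [fderiv_rotGen_sub_eq, hc30, hc31]
      have h := htransfer y hy.1 (-(y 1 - c 1)) (y 0 - c 0) (by linear_combination hrotw y hy)
      linear_combination h
    have hgerm : ∀ y ∈ O, rotGen (curl (v s) y) = fderiv ℝ (curl (v s)) y (rotGen (y - c3)) :=
      fun y hy => vorticity_rotation_germ_of_stream hψ2 hcomp hOo c3 hrotψ hy
    exact nonflatLiouville_of_curl_rotDefect_eq_zero_on_open hrate hcont hmild hdiv hpol c3 hs hOo hOne hgerm
  · -- LINES: translation germ along `e = J ∇ₕw(y₁)`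
    rw [hιy₁] at hg₀ hlines
    set g0 := fderiv ℝ w y₁ (EuclideanSpace.single 0 (1 : ℝ)) with hg0
    set g1 := fderiv ℝ w y₁ (EuclideanSpace.single 1 (1 : ℝ)) with hg1
    set e : EuclideanSpace ℝ (Fin 3) := (-g1) • EuclideanSpace.single 0 (1 : ℝ) + g0 • EuclideanSpace.single 1 (1 : ℝ) with he
    have he0 : e ≠ 0 := by
      intro h0
      have h0' : e 0 = 0 ∧ e 1 = 0 := by rw [h0]; simp
      simp [he] at h0'
      rcases hg₀ with h | h
      · exact h h0'.2
      · exact h h0'.1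
    -- `∇ₕw(y) ∥ (g0,g1)` on `O`: `−g1 ∂₀w(y) + g0 ∂₁w(y) = 0`
    have hparw : ∀ y ∈ O, (-g1) * fderiv ℝ w y (EuclideanSpace.single 0 (1 : ℝ)) + g0 * fderiv ℝ w y (EuclideanSpace.single 1 (1 : ℝ)) = 0 := by
      intro y hy
      have hl' := hlines (π y) hy.2   -- ∂₀w(yf) * g1 = ∂₁w(yf) * g0
      have hl : fderiv ℝ w (WithLp.toLp 2 ![y 0, y 1, z₁]) (EuclideanSpace.single 0 (1 : ℝ)) * g1 =
          fderiv ℝ w (WithLp.toLp 2 ![y 0, y 1, z₁]) (EuclideanSpace.single 1 (1 : ℝ)) * g0 := by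
        simpa [hπ] using hl'
      have hp := hpar y hy          -- ∂₀w(y) ∂₁w(yf) − ∂₁w(y) ∂₀w(yf) = 0
      rcases hnd _ (hfootB y hy) with h | h
      · have : fderiv ℝ w (WithLp.toLp 2 ![y 0, y 1, z₁]) (EuclideanSpace.single 0 (1 : ℝ)) *
            ((-g1) * fderiv ℝ w y (EuclideanSpace.single 0 (1 : ℝ)) + g0 * fderiv ℝ w y (EuclideanSpace.single 1 (1 : ℝ))) = 0 := by
          linear_combination (-(fderiv ℝ w y (EuclideanSpace.single 0 (1 : ℝ)))) * hl - g0 * hp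
        exact (mul_eq_zero.mp this).resolve_left h
      · have : fderiv ℝ w (WithLp.toLp 2 ![y 0, y 1, z₁]) (EuclideanSpace.single 1 (1 : ℝ)) *
            ((-g1) * fderiv ℝ w y (EuclideanSpace.single 0 (1 : ℝ)) + g0 * fderiv ℝ w y (EuclideanSpace.single 1 (1 : ℝ))) = 0 := by
          linear_combination (-(fderiv ℝ w y (EuclideanSpace.single 1 (1 : ℝ)))) * hl - g1 * hp
        exact (mul_eq_zero.mp this).resolve_left h
    have htrψ : ∀ y ∈ O, fderiv ℝ ψ y e = 0 := by
      intro y hy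
      have h := htransfer y hy.1 (-g1) g0 (hparw y hy)
      rw [he, map_add, map_smul, map_smul, smul_eq_mul, smul_eq_mul]
      linear_combination h
    have hgerm : ∀ y ∈ O, fderiv ℝ (curl (v s)) y e = 0 :=
      fun y hy => vorticity_translation_germ_of_stream hψ2 hcomp hOo htrψ hy
    exact nonflatLiouville_of_local_curl_translation hrate hcont hmild hdiv hs he0 hOo hOne hgerm

end Summit.NavierStokesRegularity.NavierStokesRegularity.Theorems.PoloidalWindowDoorPoloidalWindowRigidityUntwistedEndgame

end
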